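import Summits.ResolutionOfSingularities.ResolutionOfSingularities.Theorems.SeparableGaloisGaloisQuotientModelsDefs
import Literature.AlgebraicGeometry.Resolution.LogRegularEquivariantResolution
import Literature.AlgebraicGeometry.Resolution.AlterationsResolution
import Literature.AlgebraicGeometry.Motives.RatFnBirational
import Mathlib.AlgebraicGeometry.Morphisms.Separated
import Mathlib.AlgebraicGeometry.Morphisms.Immersion
import Mathlib.CategoryTheory.Limits.Shapes.Pullback.Equalizer
import HarnessLib

/-!
# Crux `GaloisQuotientModels` (stmt-ResolutionOfSingularities-18955), line `inseparability-foliation-quotient`: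
# stub `stub_equivariantLogResolution`, conditional form on the named fact
# `IllusieTemkin2014_equivariantLogRegularResolution`

Route `ResolutionOfSingularities/SeparableGalois`; registered stub of the line skeleton
`Cruxes/GaloisQuotientModels/Lines/inseparability_foliation_quotient.lean` (lead's reshape, 2026-08-17).
Vocabulary: `Theorems/SeparableGaloisGaloisQuotientModelsDefs.lean` (`IsLogEquivariant`).

## Statement

`stub_equivariantLogResolution`: a quasi-compact integral scheme `Z` carrying a LOG REGULAR atlas of
fs Zariski charts `𝒜` (Kato 1994, (1.5), (2.1)), a finite group `G` acting on `Z` by log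
automorphisms (`IsLogEquivariant 𝒜 ρZ`), every finite subset of `Z` in an affine open — has a
`G`-EQUIVARIANT resolution: `X'` integral and regular with an action `ρ'`, `r : X' → Z` proper,
birational, dominant and `G`-equivariant, finite subsets of `X'` in affine opens, `r♯ : K(Z) → K(X')`
bijective, and `ρ'` faithful when `ρZ` is.

## Status: named-fact level

Mathematically this is Kato 1994, (10.4) (= Nizioł 2006, Thm. 5.8: a log regular Zariski scheme is
desingularised by a log blow-up `(Z, M) ×_{F(Z)} F' → Z`, `F'` a proper subdivision of the finite
fan `F(Z)` by free monoids) made FUNCTORIAL — Illusie–Temkin's monoidal desingularisation functor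
`F̃^log` (Illusie–Laszlo–Orgogozo, Astérisque 363–364 (2014), Exp. VIII, Thm. 3.4.9/3.4.15): the
subdivision is chosen canonically, hence `G`-stably, and the universal property Kato (9.9)(2) of
`(Z, M) ×_{F(Z)} F'` lifts the log automorphisms. None of this (fans, log blow-ups) is in the tree,
so the theorem is vendored as the named fact
`Literature.AlgebraicGeometry.Resolution.IllusieTemkin2014_equivariantLogRegularResolution`
(`Literature/AlgebraicGeometry/Resolution/LogRegularEquivariantResolution.lean`, where the sources
are quoted), and this file proves the registered statement CONDITIONALLY on it:
`stub_equivariantLogResolution_of_illusieTemkin2014`.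

## Proof of the reduction

The fact gives `X'`, `ρ'`, `r` proper birational equivariant with `X'` regular and the transfer of
"finite subsets in affine opens". The remaining clauses: `X'` is reduced (regular, Matsumura 14.3,
`Scheme.IsRegular.isReduced`) hence integral, being birational onto the integral `Z`
(`IsBirational.isIntegral`); `r` is dominant (`IsBirational.isDominant`); `r♯` is bijective because
`r` is an isomorphism over a dense open with dense preimage
(`functionFieldMap_bijective_of_isIso_morphismRestrict`, Görtz–Wedhorn I, Def. 9.33); and
FAITHFULNESS transfers: if `ρ' g = 1` then `r ≫ ρZ g = ρ' g ≫ r = r`, and an endomorphism `σ` of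
the reduced `Z` with `r ≫ σ = r` for a proper dominant — hence SURJECTIVE — `r` is the identity
(`hom_eq_id_of_comp_eq`, via `ext_of_surjective`: the equalizer of `σ` and `𝟙` is an immersion
through which the surjective `r` factors, so it is a surjective closed immersion into a reduced
scheme, an isomorphism; no separatedness of `Z` is needed), so `ρZ g = 1` and `g = 1`.

## Sources

K. Kato, *Toric singularities*, Amer. J. Math. 116 (1994), (9.9)–(9.11), (10.3)–(10.4);
W. Nizioł, J. Algebraic Geom. 15 (2006), Prop. 4.3, Thm. 5.8, 5.10; L. Illusie, M. Temkin,
Astérisque 363–364 (2014), Exp. VIII, Thm. 3.4.9, 3.4.15; U. Görtz, T. Wedhorn, *Algebraic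
Geometry I*, Def. 9.33; The Stacks Project, Tag 01KM (equalizers and the diagonal).
-/

noncomputable section

-- single-problem summit: the doubled namespace component `ResolutionOfSingularities` is forced
set_option linter.dupNamespace false

open CategoryTheory CategoryTheory.Limits AlgebraicGeometry TopologicalSpace
open Literature.AlgebraicGeometry.Resolution
open Literature.AlgebraicGeometry.Motives Literature.AlgebraicGeometry.Motives.RatFn

namespace Summit.ResolutionOfSingularities.ResolutionOfSingularities.Theorems.GaloisQuotientModels

/-- **Two morphisms out of a reduced scheme which agree after a SURJECTIVE morphism are equal**
(no separatedness needed): the equalizer `E ↪ X` is an immersion (a base change of the diagonal of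
`Y`, an immersion for every scheme, Stacks 01KJ/01KM); it is surjective because the surjective `ι`
factors through it; so it is a surjective closed immersion into the reduced `X`, an isomorphism.
Compare Mathlib's `ext_of_isDominant_of_isSeparated` (dominant `ι`, separated target).
[folklore] -/
theorem ext_of_surjective {X Y W : Scheme.{0}} [IsReduced X] {f g : X ⟶ Y} (ι : W ⟶ X)
    [Surjective ι] (hU : ι ≫ f = ι ≫ g) : f = g := by
  haveI : IsImmersion (equalizer.ι f g) :=
    MorphismProperty.of_isPullback (isPullback_equalizer_prod f g).flip inferInstance
  haveI : Surjective (equalizer.ι f g) := by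
    have h : Surjective (equalizer.lift ι hU ≫ equalizer.ι f g) := by
      rw [equalizer.lift_ι]; infer_instance
    exact Surjective.of_comp (equalizer.lift ι hU) _
  haveI : IsClosedImmersion (equalizer.ι f g) :=
    .of_isPreimmersion _ (by rw [(equalizer.ι f g).surjective.range_eq]; exact isClosed_univ)
  haveI := isIso_of_isClosedImmersion_of_surjective (equalizer.ι f g)
  rw [← cancel_epi (equalizer.ι f g)]
  exact equalizer.condition f g

/-- **An endomorphism under which a proper dominant morphism is invariant is the identity** (on a
reduced target): `r ≫ σ = r` with `r` proper and dominant — hence surjective (closed dense image) —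
forces `σ = 𝟙` by `ext_of_surjective`. This is why a group acting compatibly upstairs and
downstairs acts faithfully upstairs as soon as it does downstairs. [folklore] -/
theorem hom_eq_id_of_comp_eq {X' Z : Scheme.{0}} [IsReduced Z] (r : X' ⟶ Z) [IsProper r]
    [IsDominant r] (σ : Z ⟶ Z) (h : r ≫ σ = r) : σ = 𝟙 Z := by
  haveI : Surjective r := surjective_of_isDominant_of_isClosed_range r r.isClosedMap.isClosed_range
  exact ext_of_surjective r (by rw [h, Category.comp_id])

/-- **The registered stub `stub_equivariantLogResolution`, conditionally on the named fact
`IllusieTemkin2014_equivariantLogRegularResolution`** (Illusie–Temkin, Astérisque 363–364, Exp. VIII,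
Thm. 3.4.9/3.4.15 = Kato 1994 (10.4) made functorial; Nizioł 2006 Thm. 5.8/5.10): a quasi-compact
integral log regular `Z` with a finite group `G` acting by log automorphisms and all finite subsets
in affine opens has a `G`-EQUIVARIANT resolution `r : X' → Z` — `X'` integral regular with a
`G`-action `ρ'`, `r` proper birational dominant equivariant, finite subsets of `X'` in affine opens.
The two bookkeeping clauses not in the fact are derived here: `r♯ : K(Z) → K(X')` is bijective
because `r` is an isomorphism over a dense open with dense preimage
(`functionFieldMap_bijective_of_isIso_morphismRestrict`), and FAITHFULNESS transfers from `ρZ` to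
`ρ'`: if `ρ' g = 1` then `r ≫ ρZ g = r`, so `ρZ g = 1` by `hom_eq_id_of_comp_eq` (`r` proper
dominant, `Z` reduced). Integrality of `X'`: regular ⇒ reduced, and birational onto the integral
`Z` (`IsBirational.isIntegral`); dominance: `IsBirational.isDominant`.
[cite: IllusieTemkin2014ExpVIII, Thm. 3.4.9 and 3.4.15] [cite: Kato1994, (9.9)(2), (10.3), (10.4)]
[cite: Niziol2006, Thm. 5.8 and 5.10] -/
theorem stub_equivariantLogResolution_of_illusieTemkin2014
    (hIT : IllusieTemkin2014_equivariantLogRegularResolution.{0})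
    (Z : Scheme.{0}) [IsIntegral Z] [CompactSpace Z]
    (𝒜 : LogAtlas.{0} Z) (G : Type) [Group G] [Finite G] (ρZ : G →* Aut Z) (h𝒜 : 𝒜.IsLogRegular)
    (heqv : IsLogEquivariant 𝒜 ρZ)
    (haff : ∀ S : Finset Z, ∃ U : Z.Opens, IsAffineOpen U ∧ (↑S : Set Z) ⊆ U) :
    ∃ (X' : Scheme.{0}) (_ : IsIntegral X') (ρ' : G →* Aut X') (r : X' ⟶ Z) (_ : IsDominant r),
      IsProper r ∧ IsBirational r ∧ Scheme.IsRegular X' ∧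
      (∀ g : G, (ρ' g).hom ≫ r = r ≫ (ρZ g).hom) ∧
      (∀ S : Finset X', ∃ U : X'.Opens, IsAffineOpen U ∧ (↑S : Set X') ⊆ U) ∧
      Function.Bijective (functionFieldMap r) ∧
      (Function.Injective ρZ → Function.Injective ρ') := by
  obtain ⟨X', ρ', r, hprop, hbir, hreg, hcomm, hAF⟩ := hIT Z 𝒜 G ρZ ‹_› ‹_› h𝒜 heqv
  haveI : IsReduced X' := hreg.isReduced
  haveI : IsIntegral X' := hbir.isIntegral
  haveI : IsDominant r := hbir.isDominant
  haveI : IsProper r := hprop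
  refine ⟨X', inferInstance, ρ', r, inferInstance, hprop, hbir, hreg, hcomm, hAF haff, ?_, ?_⟩
  · obtain ⟨U, hU, hU', hiso⟩ := hbir
    exact functionFieldMap_bijective_of_isIso_morphismRestrict r U hU hU'
  · intro hinj
    refine (injective_iff_map_eq_one ρ').2 fun g hg => (injective_iff_map_eq_one ρZ).1 hinj g ?_
    have h1 : r ≫ (ρZ g).hom = r := by rw [← hcomm g, hg]; exact Category.id_comp r
    exact Aut.ext (hom_eq_id_of_comp_eq r (ρZ g).hom h1)

end Summit.ResolutionOfSingularities.ResolutionOfSingularities.Theorems.GaloisQuotientModels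

end
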